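import Literature.MathematicalPhysics.QuantumFieldTheory.Balaban1983to89.B7Prop4GeneralLevels
import Literature.MathematicalPhysics.QuantumFieldTheory.Balaban1983to89.B12Ineq417Flat

/-!
# `Balaban1983to89.B7TranslationCovariance` — [Balaban1985Averaging] Sects. A–D at a GENERAL background on `ℤ^d`: the JOINT
translation covariance of the averaging operations (43), of the moving-frame objects (55), (58), (62)/(82), (65), (89), of the
one-step maps (121)–(122) and of the composites (127) — `Q_j(U₀, B)(z + a) = Q_j(t_{L^ja}U₀, t_{L^ja}B)(z)` — PROVED; and, as its
application, the three-term form of [Balaban1987RG1] (4.16) at a general background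

HONEST FRAMING (cell `lit-balaban`, verbatim): statement-level skeleton of published theorems with citation tags; proofs where
landed; nothing here is a claim about the Yang–Mills mass gap.

CITATION HEADER.  T. Bałaban, *Averaging operations for lattice gauge theories*, Commun. Math. Phys. **98** (1985) 17–51
[Balaban1985Averaging] (cell paper B7; journal page = PDF page + 16): (1) p. 17 and p. 19 (the lattices `Ω^{(j)} = L^jηℤ^d`, «`Ω^{(j)}`
may be replaced by any other lattice»), (42)–(43) pp. 23–24, (55)–(58) p. 27, (62) p. 28, (65) p. 29, (82) p. 30, (89)–(91) p. 31,
(121)–(122) p. 36, (127) p. 37; T. Bałaban, *Renormalization group approach to lattice gauge field theories. I*, Commun. Math. Phys.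
**109** (1987) 249–301 [Balaban1987RG1] (cell paper B12; journal page = PDF page + 248), (4.16) p. 285 («The operation Q_{j,μ} is
translation invariant, i.e., Q_{j,μ}(ηA, x+a) = Q_{j,μ}(ηt_aA, x)»), (4.19) p. 285 (the derivatives are taken at the background
`U_j(□₀, 1)`).  Unit `lit-balaban-r20` gen 4 (fold owner of B12; this file is a SUPPLEMENT on the concrete `ℤ^d` objects of the B7
lineage — b07's `B7Prop1Explicit`/`B7Prop2Explicit`/`B7Prop3Flat`, NE7c's `B7Eq92Concrete`/`B7Prop3GeneralLinear`/`B7Prop4GeneralLevels`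
— restating none of them; B7 rows of record are r04's).  It answers, as a first instalment, the NE9 owner's NEED-3 (a) (HOME/INBOX
2026-08-21T03:5xZ): the (4.16)/(4.17) mechanism of `B12Ineq417Flat` (flat background) transported to a general background `U₀`.

WHY.  `B12Ineq417Flat.logIter_shiftCfg` proves the printed translation invariance for the FLAT composite averaging `Q_j(1, ·)`.
At a general background `U₀` the composite `Q_j(U₀, ·)` of (127) (`B7Prop4GeneralLevels.logCovIter`) is translation COVARIANT
jointly in the pair `(U₀, B)`: translating the bond `c` of the `j`-th lattice by `a` is translating BOTH the background and the
field on the fine lattice by `L^ja`.  Consequently the unit-lattice derivative of the localized field `B_μ = ζ̃·Q_{j,μ}(U₀, B)` of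
[Balaban1987RG1] p. 284 splits into THREE terms (`eq416_general_split`): the `ζ̃`-difference term, the FIELD-variation term
`Q_j(t U₀, t B) − Q_j(t U₀, B)` (the one bounded by Proposition 5 of [7], (156), at the background `t U₀`), and a BACKGROUND-variation
term `Q_j(t U₀, B) − Q_j(U₀, B)`, which vanishes when `U₀` is invariant under the translation (`eq416_general_split_of_invariant`) —
in particular at `U₀ = 1`, where the split is `B12Ineq417Flat.eq416_flat_split` (`dlocBG_one`).

DICTIONARY (as in `B7Eq92Concrete`/`B7Prop4GeneralLevels`/`B12Ineq417Flat`).  Every level `Ω^{(j)}` is `ℤ^d` (`B7Prop1Explicit.Site d`),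
bonds `(x, κ)`; the translation `t_a` is `B12Ineq417Flat.shiftCfg a` (`(t_aF)(x) = F(x + a)`), acting on site functions, bond
configurations `Site d → Fin d → G` and gauge functions alike; a translation by `a` of the `j`-th lattice is `t_{L^ja}` on the fine
lattice.  Objects: `avgIter L U j` = `Ū^j` (43); `mgauge` (55); `tHol V₀ V₁ y Γ` = `(R_{0,y}V₁)(Γ)` (58); `Fcov`/`wframe` = the block frame
(62)/(82); `tild` (65); `dbavgCov` (89); `Qcov L V₀ A c = Q(V₀, A, c)` (121), `linQcov`/`Ccov` (122); `logCovIter L U₀ B j` = `Q_j(U₀, B)`,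
`linCovIter` = `L^jηQ_j(U₀)` (127)/(150).

WHAT THIS FILE PROVES (kernel, 0 sorry, standard axioms; object definitions `locBG`, `dlocBG`, no `def … : Prop`):
* §1 `mgauge_shiftCfg`, `tHol_shiftCfg`, `Fcov_shiftCfg`, `wframe_shiftCfg`, `tild_shiftCfg`, `dbavgCov_shiftCfg`, `Qcov_shiftCfg`,
  `linQcov_shiftCfg`, `Ccov_shiftCfg` (one step, translation by any `a ∈ ℤ^d`), `avgIter_shiftCfg` (`Ū^j(z + a) = \overline{t_{L^ja}U}^j(z)`),
  **`logCovIter_shiftCfg`** (`Q_j(U₀, B)(z + a) = Q_j(t_{L^ja}U₀, t_{L^ja}B)(z)`) and `linCovIter_shiftCfg`.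
* §2 `locBG`/`dlocBG` (the localized field `B_μ = ζ̃·Q_{j,μ}(U₀, B)` and `∂_νB_μ` at a general background), `locBG_one`/`dlocBG_one`
  (flat reductions to `B12Ineq417Flat.locB`/`dlocB`), **`eq416_general_split`** (three terms), `eq416_general_split_of_invariant` (two
  terms when `t_{L^je_ν}U₀ = U₀`).

DIVERGENCES / NOT PROVED.  `ℤ^d`, no torus (a periodisation/torus twin — NEED-3 (c) — is not attempted); the print states translation
INVARIANCE for the averaging used in [Balaban1987RG1] §4, whose derivatives are taken at `U_j(□₀, 1)` ((4.19)); the covariance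
statement for a general `U₀` is the elementary extension recorded here, not a displayed formula of either paper; (4.17) at a general
background is NOT proved here: it needs Proposition 5 of [7] at `U₀` in operator form (the tree's `B7Prop5GeneralInduction.prop5_156`
carries the one-step inputs (139), (145), (148), (131), (155) as hypotheses) and a bound on the background-variation term (a
Proposition 6-type statement of [7]); both are left to the consumers.
-/

noncomputable section

open scoped BigOperators
open Literature.MathematicalPhysics.QuantumFieldTheory.Balaban1983to89
open Literature.MathematicalPhysics.QuantumFieldTheory.Balaban1983to89.B7Prop1Explicit (Letter e hol stepHol treeWord seg boxVec
  bavg expUnit)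
open Literature.MathematicalPhysics.QuantumFieldTheory.Balaban1983to89.B7Prop2Explicit (rescale avgIter avgIter_succ)
open Literature.MathematicalPhysics.QuantumFieldTheory.Balaban1983to89.B7Prop3Flat (expCfg)
open Literature.MathematicalPhysics.QuantumFieldTheory.Balaban1983to89.B7Prop4Flat (logIter)
open Literature.MathematicalPhysics.QuantumFieldTheory.Balaban1983to89.B7Eq92Concrete (Rc mgauge tHol Fcov wframe tild dbavgCov)
open Literature.MathematicalPhysics.QuantumFieldTheory.Balaban1983to89.B7Prop3GeneralLinear (Qcov linQcov Ccov)
open Literature.MathematicalPhysics.QuantumFieldTheory.Balaban1983to89.B7Prop4GeneralLevels (logCovIter linCovIter logCovIter_succ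
  linCovIter_succ logCovIter_one_left)
open Literature.MathematicalPhysics.QuantumFieldTheory.Balaban1983to89.B12Ineq417Flat (shiftCfg shiftCfg_apply shiftCfg_shiftCfg
  hol_shiftCfg bavg_shiftCfg expCfg_shiftCfg locB dlocB logIter_shiftCfg)

namespace Literature.MathematicalPhysics.QuantumFieldTheory.Balaban1983to89.B7TranslationCovariance

variable {d : ℕ}

/-! ## §1 Joint translation covariance of the general-background objects of [Balaban1985Averaging] -/

section Group

variable {G : Type*} [Group G]

/-- Translations commute with pointwise products of bond configurations. [cite: Balaban1985Averaging, (55) p.27] (elementary API;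
our proof) -/
theorem shiftCfg_mul (a : B7Prop1Explicit.Site d) (V W : B7Prop1Explicit.Site d → Fin d → G) :
    shiftCfg a (V * W) = shiftCfg a V * shiftCfg a W := rfl

/-- Translation of the unit configuration. [cite: Balaban1985Averaging, (65) p.29] (elementary API; our proof) -/
@[simp] theorem shiftCfg_one (a : B7Prop1Explicit.Site d) : shiftCfg a (1 : B7Prop1Explicit.Site d → Fin d → G) = 1 := rfl

/-- **(55) is translation covariant**: the moving-frame gauge action of the translated data is the translate of the action,
`(t_aV₁)^{t_av}` relative to `t_aV₀` `= t_a(V₁^v)`. [cite: Balaban1985Averaging, (55) p.27] (elementary API; our proof) -/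
theorem mgauge_shiftCfg (a : B7Prop1Explicit.Site d) (V₀ : B7Prop1Explicit.Site d → Fin d → G) (v : B7Prop1Explicit.Site d → G)
    (V₁ : B7Prop1Explicit.Site d → Fin d → G) :
    mgauge (shiftCfg a V₀) (shiftCfg a v) (shiftCfg a V₁) = shiftCfg a (mgauge V₀ v V₁) := by
  funext x κ
  simp only [B7Eq92Concrete.mgauge_apply, shiftCfg_apply, add_right_comm x (e κ) a]

/-- **(58) is translation covariant**: `(R_{0,y}(t_aV₁))(Γ)` relative to `t_aV₀` equals `(R_{0,y+a}V₁)(Γ)` relative to `V₀`.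
[cite: Balaban1985Averaging, (58) p.27] (elementary API; our proof) -/
theorem tHol_shiftCfg (a : B7Prop1Explicit.Site d) (V₀ V₁ : B7Prop1Explicit.Site d → Fin d → G) (y : B7Prop1Explicit.Site d)
    (w : List (Letter d)) : tHol (shiftCfg a V₀) (shiftCfg a V₁) y w = tHol V₀ V₁ (y + a) w := by
  unfold tHol
  rw [← shiftCfg_mul, hol_shiftCfg, hol_shiftCfg]

end Group

section OneStep

variable {𝔸 : Type*} [NormedRing 𝔸] [NormedAlgebra ℂ 𝔸] [CompleteSpace 𝔸]

omit [CompleteSpace 𝔸] in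
/-- **The block-frame exponent (62)/(82) is translation covariant.** [cite: Balaban1985Averaging, (62) p.28, (82) p.30]
(elementary API; our proof) -/
theorem Fcov_shiftCfg (L : ℕ) (a : B7Prop1Explicit.Site d) (V₀ V₁ : B7Prop1Explicit.Site d → Fin d → 𝔸ˣ)
    (y : B7Prop1Explicit.Site d) : Fcov L (shiftCfg a V₀) (shiftCfg a V₁) y = Fcov L V₀ V₁ (y + a) := by
  unfold Fcov
  simp_rw [tHol_shiftCfg]

/-- **The block frame `\overline{R_{0,y}V₁}` (82) is translation covariant.** [cite: Balaban1985Averaging, (82) p.30]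
(elementary API; our proof) -/
theorem wframe_shiftCfg (L : ℕ) (a : B7Prop1Explicit.Site d) (V₀ V₁ : B7Prop1Explicit.Site d → Fin d → 𝔸ˣ)
    (y : B7Prop1Explicit.Site d) : wframe L (shiftCfg a V₀) (shiftCfg a V₁) y = wframe L V₀ V₁ (y + a) := by
  unfold wframe
  rw [Fcov_shiftCfg]

/-- **(65) `Ṽ₁ = (\overline{V₁V₀})(V̄₀)⁻¹` is translation covariant.** [cite: Balaban1985Averaging, (65) p.29] (elementary API; our proof) -/
theorem tild_shiftCfg (L : ℕ) (a : B7Prop1Explicit.Site d) (V₀ V₁ : B7Prop1Explicit.Site d → Fin d → 𝔸ˣ)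
    (q : B7Prop1Explicit.Site d) (κ : Fin d) : tild L (shiftCfg a V₀) (shiftCfg a V₁) q κ = tild L V₀ V₁ (q + a) κ := by
  simp only [B7Eq92Concrete.tild_apply, ← shiftCfg_mul, bavg_shiftCfg]

/-- **The double-bar average (89) at a general background is translation covariant (jointly in background and field).**
[cite: Balaban1985Averaging, (89) p.31] (elementary API; our proof) -/
theorem dbavgCov_shiftCfg (L : ℕ) (a : B7Prop1Explicit.Site d) (V₀ V₁ : B7Prop1Explicit.Site d → Fin d → 𝔸ˣ)
    (q : B7Prop1Explicit.Site d) (κ : Fin d) :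
    dbavgCov L (shiftCfg a V₀) (shiftCfg a V₁) q κ = dbavgCov L V₀ V₁ (q + a) κ := by
  rw [B7Eq92Concrete.dbavgCov_apply, B7Eq92Concrete.dbavgCov_apply, wframe_shiftCfg, wframe_shiftCfg, tild_shiftCfg,
    bavg_shiftCfg, add_right_comm q ((L : ℤ) • e κ) a]

/-- **The one-step map (121) `Q(V₀, A, c)` is translation covariant jointly in `(V₀, A)`.** [cite: Balaban1985Averaging, (121) p.36]
(elementary API; our proof) -/
theorem Qcov_shiftCfg (L : ℕ) (a : B7Prop1Explicit.Site d) (V₀ : B7Prop1Explicit.Site d → Fin d → 𝔸ˣ)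
    (A : B7Prop1Explicit.Site d → Fin d → 𝔸) (q : B7Prop1Explicit.Site d) (κ : Fin d) :
    Qcov L (shiftCfg a V₀) (shiftCfg a A) q κ = Qcov L V₀ A (q + a) κ := by
  unfold Qcov
  rw [expCfg_shiftCfg, dbavgCov_shiftCfg]

/-- **The linear part (122) `L(Q(V₀)A)_c` is translation covariant jointly in `(V₀, A)`** (derivative along the ray of the covariant
`Q`). [cite: Balaban1985Averaging, (122) p.36] (elementary API; our proof) -/
theorem linQcov_shiftCfg (L : ℕ) (a : B7Prop1Explicit.Site d) (V₀ : B7Prop1Explicit.Site d → Fin d → 𝔸ˣ)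
    (A : B7Prop1Explicit.Site d → Fin d → 𝔸) (q : B7Prop1Explicit.Site d) (κ : Fin d) :
    linQcov L (shiftCfg a V₀) (shiftCfg a A) q κ = linQcov L V₀ A (q + a) κ := by
  unfold linQcov
  congr 1
  funext t
  have : t • shiftCfg a A = shiftCfg a (t • A) := rfl
  rw [this, Qcov_shiftCfg]

/-- **The remainder (122) `C(V₀, A, c)` is translation covariant jointly in `(V₀, A)`.** [cite: Balaban1985Averaging, (122) p.36]
(elementary API; our proof) -/
theorem Ccov_shiftCfg (L : ℕ) (a : B7Prop1Explicit.Site d) (V₀ : B7Prop1Explicit.Site d → Fin d → 𝔸ˣ)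
    (A : B7Prop1Explicit.Site d → Fin d → 𝔸) (q : B7Prop1Explicit.Site d) (κ : Fin d) :
    Ccov L (shiftCfg a V₀) (shiftCfg a A) q κ = Ccov L V₀ A (q + a) κ := by
  unfold Ccov
  rw [Qcov_shiftCfg, linQcov_shiftCfg]

end OneStep

section Iterates

variable {𝔸 : Type*} [NormedRing 𝔸] [NormedAlgebra ℂ 𝔸] [CompleteSpace 𝔸]

/-- **The `j`-fold average (43) is translation covariant**: a translation by `a` of the `j`-th lattice is the translation by
`L^ja` of the original lattice, `Ū^j(z + a, κ) = \overline{(t_{L^ja}U)}^j(z, κ)` (p. 19: «`Ω^{(j)}` may be replaced by any other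
lattice»). [cite: Balaban1985Averaging, (43) p.24, (1) p.17, p.19] -/
theorem avgIter_shiftCfg (L : ℕ) (U : B7Prop1Explicit.Site d → Fin d → 𝔸ˣ) :
    ∀ (j : ℕ) (a z : B7Prop1Explicit.Site d) (κ : Fin d),
      avgIter L U j (z + a) κ = avgIter L (shiftCfg (((L : ℤ) ^ j) • a) U) j z κ
  | 0, a, z, κ => by simp [shiftCfg]
  | j + 1, a, z, κ => by
    rw [avgIter_succ, avgIter_succ, B7Prop2Explicit.rescale_apply, B7Prop2Explicit.rescale_apply, smul_add]
    have hE : shiftCfg ((L : ℤ) • a) (avgIter L U j) = avgIter L (shiftCfg (((L : ℤ) ^ (j + 1)) • a) U) j := by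
      funext x μ
      rw [shiftCfg_apply, avgIter_shiftCfg L U j ((L : ℤ) • a) x μ, smul_smul, ← pow_succ]
    rw [← bavg_shiftCfg L ((L : ℤ) • a) (avgIter L U j) ((L : ℤ) • z) κ, hE]

/-- The translate of the `j`-th level background as a configuration: `t_a(Ū₀^j) = \overline{(t_{L^ja}U₀)}^j`.
[cite: Balaban1985Averaging, (43) p.24] (elementary API; our proof) -/
theorem shiftCfg_avgIter (L : ℕ) (U : B7Prop1Explicit.Site d → Fin d → 𝔸ˣ) (j : ℕ) (a : B7Prop1Explicit.Site d) :
    shiftCfg a (avgIter L U j) = avgIter L (shiftCfg (((L : ℤ) ^ j) • a) U) j := by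
  funext z κ
  rw [shiftCfg_apply, avgIter_shiftCfg]

/-- **JOINT TRANSLATION COVARIANCE OF THE COMPOSITE AVERAGING (127) AT A GENERAL BACKGROUND**:
`Q_j(U₀, B)(z + a, κ) = Q_j(t_{L^ja}U₀, t_{L^ja}B)(z, κ)` — the general-background form of [Balaban1987RG1]'s «Q_{j,μ}(ηA, x+a) =
Q_{j,μ}(ηt_aA, x)» (which is the case of a translation-invariant background; at `U₀ = 1` this is
`B12Ineq417Flat.logIter_shiftCfg`). [cite: Balaban1985Averaging, (127) p.37; Balaban1987RG1, (4.16) p.285] -/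
theorem logCovIter_shiftCfg (L : ℕ) (U₀ : B7Prop1Explicit.Site d → Fin d → 𝔸ˣ) (B : B7Prop1Explicit.Site d → Fin d → 𝔸) :
    ∀ (j : ℕ) (a z : B7Prop1Explicit.Site d) (κ : Fin d),
      logCovIter L U₀ B j (z + a) κ
        = logCovIter L (shiftCfg (((L : ℤ) ^ j) • a) U₀) (shiftCfg (((L : ℤ) ^ j) • a) B) j z κ
  | 0, a, z, κ => by simp [shiftCfg]
  | j + 1, a, z, κ => by
    rw [logCovIter_succ, logCovIter_succ, smul_add]
    have hE : shiftCfg ((L : ℤ) • a) (logCovIter L U₀ B j)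
        = logCovIter L (shiftCfg (((L : ℤ) ^ (j + 1)) • a) U₀) (shiftCfg (((L : ℤ) ^ (j + 1)) • a) B) j := by
      funext x μ
      rw [shiftCfg_apply, logCovIter_shiftCfg L U₀ B j ((L : ℤ) • a) x μ, smul_smul, ← pow_succ]
    have hA : shiftCfg ((L : ℤ) • a) (avgIter L U₀ j) = avgIter L (shiftCfg (((L : ℤ) ^ (j + 1)) • a) U₀) j := by
      rw [shiftCfg_avgIter, smul_smul, ← pow_succ]
    rw [← hA, ← hE, Qcov_shiftCfg]

/-- **Joint translation covariance of the composed linear parts** `L^jηQ_j(U₀)`: `(L^jηQ_j(U₀)B)(z + a) =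
(L^jηQ_j(t_{L^ja}U₀)(t_{L^ja}B))(z)`. [cite: Balaban1985Averaging, (127) p.37, (150) p.40] -/
theorem linCovIter_shiftCfg (L : ℕ) (U₀ : B7Prop1Explicit.Site d → Fin d → 𝔸ˣ) (B : B7Prop1Explicit.Site d → Fin d → 𝔸) :
    ∀ (j : ℕ) (a z : B7Prop1Explicit.Site d) (κ : Fin d),
      linCovIter L U₀ B j (z + a) κ
        = linCovIter L (shiftCfg (((L : ℤ) ^ j) • a) U₀) (shiftCfg (((L : ℤ) ^ j) • a) B) j z κ
  | 0, a, z, κ => by simp [shiftCfg]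
  | j + 1, a, z, κ => by
    rw [linCovIter_succ, linCovIter_succ, smul_add]
    have hE : shiftCfg ((L : ℤ) • a) (linCovIter L U₀ B j)
        = linCovIter L (shiftCfg (((L : ℤ) ^ (j + 1)) • a) U₀) (shiftCfg (((L : ℤ) ^ (j + 1)) • a) B) j := by
      funext x μ
      rw [shiftCfg_apply, linCovIter_shiftCfg L U₀ B j ((L : ℤ) • a) x μ, smul_smul, ← pow_succ]
    have hA : shiftCfg ((L : ℤ) • a) (avgIter L U₀ j) = avgIter L (shiftCfg (((L : ℤ) ^ (j + 1)) • a) U₀) j := by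
      rw [shiftCfg_avgIter, smul_smul, ← pow_succ]
    rw [← hA, ← hE, linQcov_shiftCfg]

/-- The flat case recovered: at `U₀ = 1` the joint covariance is `B12Ineq417Flat.logIter_shiftCfg` (consistency check, both sides
reduce by `B7Prop4GeneralLevels.logCovIter_one_left`). [cite: Balaban1985Averaging, (127) p.37; Balaban1987RG1, (4.16) p.285] -/
theorem logCovIter_shiftCfg_one (L : ℕ) (B : B7Prop1Explicit.Site d → Fin d → 𝔸) (j : ℕ) (a z : B7Prop1Explicit.Site d)
    (κ : Fin d) :
    logCovIter L (1 : B7Prop1Explicit.Site d → Fin d → 𝔸ˣ) B j (z + a) κ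
      = logIter L (shiftCfg (((L : ℤ) ^ j) • a) B) j z κ := by
  rw [logCovIter_shiftCfg, shiftCfg_one, logCovIter_one_left]

end Iterates

/-! ## §2 [Balaban1987RG1] (4.16) at a general background: the three-term split of `∂_νB_μ` -/

section Eq416General

variable {𝔸 : Type*} [NormedRing 𝔸] [NormedAlgebra ℂ 𝔸] [CompleteSpace 𝔸]

/-- **The localized field at a general background**: `B_μ(x) = ζ̃_□(x)·Q_{j,μ}(U₀, B)(x)` with the background-covariant composite
averaging `Q_j(U₀, ·)` of [7] (at `U₀ = 1`: `B12Ineq417Flat.locB`). [cite: Balaban1987RG1, (4.16) p.285 (p.284 l.−2); Balaban1985Averaging, (127) p.37] -/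
def locBG (ζ : B7Prop1Explicit.Site d → ℝ) (L : ℕ) (U₀ : B7Prop1Explicit.Site d → Fin d → 𝔸ˣ)
    (B : B7Prop1Explicit.Site d → Fin d → 𝔸) (j : ℕ) (z : B7Prop1Explicit.Site d) (μ : Fin d) : 𝔸 :=
  (ζ z : ℝ) • logCovIter L U₀ B j z μ

/-- **The unit-lattice derivative** `(∂_νB_μ)(x) = B_μ(x + e_ν) − B_μ(x)` at a general background. [cite: Balaban1987RG1, (4.16) p.285] -/
def dlocBG (ζ : B7Prop1Explicit.Site d → ℝ) (L : ℕ) (U₀ : B7Prop1Explicit.Site d → Fin d → 𝔸ˣ)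
    (B : B7Prop1Explicit.Site d → Fin d → 𝔸) (j : ℕ) (ν : Fin d) (z : B7Prop1Explicit.Site d) (μ : Fin d) : 𝔸 :=
  locBG ζ L U₀ B j (z + e ν) μ - locBG ζ L U₀ B j z μ

/-- Flat reduction: `locBG ζ L 1 = B12Ineq417Flat.locB ζ L`. [cite: Balaban1987RG1, (4.16) p.285] (elementary API; our proof) -/
theorem locBG_one (ζ : B7Prop1Explicit.Site d → ℝ) (L : ℕ) (B : B7Prop1Explicit.Site d → Fin d → 𝔸) (j : ℕ)
    (z : B7Prop1Explicit.Site d) (μ : Fin d) :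
    locBG ζ L (1 : B7Prop1Explicit.Site d → Fin d → 𝔸ˣ) B j z μ = locB ζ L B j z μ := by
  simp [locBG, locB, logCovIter_one_left]

/-- Flat reduction: `dlocBG ζ L 1 = B12Ineq417Flat.dlocB ζ L`. [cite: Balaban1987RG1, (4.16) p.285] (elementary API; our proof) -/
theorem dlocBG_one (ζ : B7Prop1Explicit.Site d → ℝ) (L : ℕ) (B : B7Prop1Explicit.Site d → Fin d → 𝔸) (j : ℕ) (ν : Fin d)
    (z : B7Prop1Explicit.Site d) (μ : Fin d) :
    dlocBG ζ L (1 : B7Prop1Explicit.Site d → Fin d → 𝔸ˣ) B j ν z μ = dlocB ζ L B j ν z μ := by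
  simp [dlocBG, dlocB, locBG_one]

/-- **(4.16) AT A GENERAL BACKGROUND, three-term split**: with `t = t_{L^je_ν}`,
`(∂_νB_μ)(x) = [ζ̃(x+e_ν) − ζ̃(x)]·Q_{j,μ}(U₀, B)(x+e_ν) + ζ̃(x)·[Q_{j,μ}(tU₀, tB)(x) − Q_{j,μ}(tU₀, B)(x)]
  + ζ̃(x)·[Q_{j,μ}(tU₀, B)(x) − Q_{j,μ}(U₀, B)(x)]` — the second bracket is the FIELD variation at the fixed background `tU₀` (the
object of Proposition 5 of [7]), the third the BACKGROUND variation (absent from the printed, translation-invariant case).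
[cite: Balaban1987RG1, (4.16) p.285; Balaban1985Averaging, (127) p.37] -/
theorem eq416_general_split (ζ : B7Prop1Explicit.Site d → ℝ) (L : ℕ) (U₀ : B7Prop1Explicit.Site d → Fin d → 𝔸ˣ)
    (B : B7Prop1Explicit.Site d → Fin d → 𝔸) (j : ℕ) (ν : Fin d) (z : B7Prop1Explicit.Site d) (μ : Fin d) :
    dlocBG ζ L U₀ B j ν z μ
      = (ζ (z + e ν) - ζ z) • logCovIter L U₀ B j (z + e ν) μ
        + ζ z • (logCovIter L (shiftCfg (((L : ℤ) ^ j) • e ν) U₀) (shiftCfg (((L : ℤ) ^ j) • e ν) B) j z μ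
            - logCovIter L (shiftCfg (((L : ℤ) ^ j) • e ν) U₀) B j z μ)
        + ζ z • (logCovIter L (shiftCfg (((L : ℤ) ^ j) • e ν) U₀) B j z μ - logCovIter L U₀ B j z μ) := by
  have hcov := logCovIter_shiftCfg L U₀ B j (e ν) z μ
  simp only [dlocBG, locBG]
  rw [← hcov]
  module

/-- **(4.16) for a background invariant under the translation** (`t_{L^je_ν}U₀ = U₀`, e.g. a constant background, or `U₀ = 1`):
the background-variation term vanishes and the printed two-term form survives,
`(∂_νB_μ)(x) = [ζ̃(x+e_ν) − ζ̃(x)]·Q_{j,μ}(U₀, B)(x+e_ν) + ζ̃(x)·[Q_{j,μ}(U₀, tB)(x) − Q_{j,μ}(U₀, B)(x)]`.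
[cite: Balaban1987RG1, (4.16) p.285] -/
theorem eq416_general_split_of_invariant (ζ : B7Prop1Explicit.Site d → ℝ) (L : ℕ)
    (U₀ : B7Prop1Explicit.Site d → Fin d → 𝔸ˣ) (B : B7Prop1Explicit.Site d → Fin d → 𝔸) (j : ℕ) (ν : Fin d)
    (z : B7Prop1Explicit.Site d) (μ : Fin d) (hinv : shiftCfg (((L : ℤ) ^ j) • e ν) U₀ = U₀) :
    dlocBG ζ L U₀ B j ν z μ
      = (ζ (z + e ν) - ζ z) • logCovIter L U₀ B j (z + e ν) μ
        + ζ z • (logCovIter L U₀ (shiftCfg (((L : ℤ) ^ j) • e ν) B) j z μ - logCovIter L U₀ B j z μ) := by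
  rw [eq416_general_split, hinv, sub_self, smul_zero, add_zero]

end Eq416General

end Literature.MathematicalPhysics.QuantumFieldTheory.Balaban1983to89.B7TranslationCovariance

end
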